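import Mathlib.Analysis.Calculus.Deriv.Star
import Literature.Probability.LatticeModels.PlanarIsingHalfPlaneSpinor
import HarnessLib

/-!
# CHI's continuum spinor `f_{[Ω,a;b]}` on a simply connected domain: partial fractions, primitive, covariance

Topic `Literature/Probability/LatticeModels`. Continuum layer of the programme behind the three
named facts `chi_plusTwoPoint_diagLogDerivative`, `chi_plusTwoPoint_nnRatio`,
`chi_freePlusTwoPoint_ratio` (`PlanarIsingOnePointSplit.lean`; Chelkak–Hongler–Izyurov, Ann. of
Math. 181 (2015) = arXiv:1202.2838v2, "CHI15", Thm 1.5, Remark 2.18, Thm 1.7), whose printed proofs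
(§2.6: Thms 2.15, 2.17, 2.19; §3.4–3.5) compare the discrete spinor observables with the continuum
spinor `f_{[Ω,a;b]}` of Def. 2.8 and read off its two expansion coefficients `𝒜_Ω(a;b)` (Def. 2.11,
at the source `a`) and `𝓑_Ω(a;b)` (eq. (2.12), at the second branch point `b`); equation numbers in
this file are those of arXiv:1202.2838v2, whose §2 items (Def. 2.8, Remark 2.9, Def. 2.11,
Remark 2.12, Thms 2.15/2.17/2.19, Prop. 3.9) are cited by name as well.
`PlanarIsingHalfPlaneSpinor.lean` treats the explicit half-plane solution (§2.7.2, (2.21)) through its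
**square** `spinorSqCHI a b z = f_{[ℍ,a;b]}(z)²` (a rational function). This file supplies, still in
squared (branch-free) form and with everything PROVED, the remaining continuum facts of CHI15 §2.5
and §3.3.2 for `k = 1` that the lattice analysis consumes:

* **Partial fractions** (`spinorSqCHI_eq_partialFraction`):
  `f_{[ℍ,a;b]}(z)² = 1/(z-a) - 1/(z-ā) - 𝓑_ℍ(a;b)² · (1/(z-b) - 1/(z-b̄))`, `𝓑_ℍ = bCHI`
  — the residues `1` at `a` (Def. 2.8 (2.8)) and `-𝓑²` at `b` ((2.7), (2.12)) of
  `PlanarIsingHalfPlaneSpinor` together with the Schwarz symmetry `f²(z̄) = -conj f²(z)`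
  (`spinorSqCHI_conj`, the squared form of the boundary condition (2.6) `f² ν_out ≥ 0` on `ℝ`)
  determine the rational function `f²` completely (its numerator has degree `2 < 4`). Equivalently
  (CHI15 Appendix, proof of Prop. 4.1:
  "`h = Re ∫ f² = G_ℍ(z;a) - Σ β_s² G_ℍ(z;a_s)` where `G_ℍ` is the Green's function"):
* **the primitive** `h_{[ℍ,a;b]} = Re ∫ f² dz = log|z-a| - log|z-ā| - 𝓑²(log|z-b| - log|z-b̄|)`
  (`spinorPrimCHI`, `hasFDerivAt_spinorPrimCHI`: `dh(z)[v] = Re(f(z)² v)`), which vanishes on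
  `∂ℍ = ℝ` (`spinorPrimCHI_ofReal`; Prop. 3.9 (1)) and is conformally invariant
  (`hasFDerivAt_spinorPrimCHI_comp`: `d(h ∘ φ)(z)[v] = Re(f_{[Ω,a;b]}(z)² v)`, first sentence of the
  proof of Prop. 3.9);
* **the reflections** used in the symmetrisation arguments of §3.5: `f²` is anti-invariant under the
  anti-conformal automorphism `u ↦ -ū` of `ℍ` (`spinorSqCHI_neg_conj`), whence for the reflection
  `ρ_t(z) = z̄ + 2it` in a horizontal line and the reflected chart `φ^ρ = -conj ∘ φ ∘ ρ_t` of `ρ_t(Ω)`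
  one has `f_{[ρΩ, ρa; ρb]}(w)² = conj (f_{[Ω,a;b]}(ρ w)²)` (`domainSpinorSq_reflect`; CHI15 p. 29
  "`f^{(ℛ)}(z) ≡ conj f(ℛ_a(z))`" and p. 30 "`f^{(ℛ)}(z) ≡ -conj f(ℛ_b(z))`", squared), and `φ^ρ` is
  again a conformal bijection onto `ℍ` (`IsConformalBijection.reflect`);
* **the spinor on a domain** `Ω` with a conformal bijection `φ : Ω → ℍ` (Remark 2.9 (ii), eq. (2.10):
  "`f_{[Ω,a;b]}(z) = f_{[φΩ, φa; φb]}(φ z) · φ'(z)^{1/2}` … we use this covariance property to define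
  the continuous spinor in arbitrary simply connected domain"), squared:
  `domainSpinorSq φ a b z = f_{[ℍ,φa;φb]}(φ z)² · φ'(z)`; it is holomorphic on `Ω ∖ {a, b}`
  (`differentiableOn_domainSpinorSq`), and its expansions at the two branch points are the printed
  ones: `(z-a) f² → 1` ((2.8), `tendsto_domainSpinorSq_mul_sub_left`), the continuation of
  `(z-a)f²` has derivative `4 𝒜_Ω(a;b)` at `a` with **CHI's covariance rule for `𝒜` (the display
  after Thm 1.5: (1.7) in arXiv v2, cited as (1.5) in `PlanarIsingLogDerivative.lean`; Remark 2.12)**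
  `𝒜_Ω(a;b) = 𝒜_ℍ(φa;φb) φ'(a) + φ''(a)/(8φ'(a)) = ACHI φ a b` (`hasDerivAt_domainSpinorSqMulLeft`),
  and `(z-b) f² → -𝓑_ℍ(φa;φb)²` (`tendsto_domainSpinorSq_mul_sub_right`), i.e. **the conformal
  invariance (2.13) of `𝓑`**: `𝓑_Ω(a;b) = 𝓑_ℍ(φa;φb) = bCHI (φ a) (φ b)`, the limit appearing in
  `chi_freePlusTwoPoint_ratio`.

* **the branches** (§V, Def. 2.11 un-squared): near `a` the principal square root
  `domainSpinorSqrtLeft` of the continuation of `(z-a)f²` is a holomorphic branch of `√(z-a)·f`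
  with value `1` and derivative `2𝒜_Ω(a;b)` at `a` (`exists_ball_domainSpinorSqrtLeft`:
  "`√(z-a) f = 1 + 2𝒜(z-a) + …`", (2.11)); near `b`, `domainSpinorSqrtRight = i𝓑·((z-b)f²/(-𝓑²))^{1/2}`
  is a holomorphic branch of `√(z-b)·f` with value `+i𝓑_Ω(a;b)` at `b`
  (`exists_ball_domainSpinorSqrtRight`: "`f = ± i𝓑 (z-b)^{-1/2} + O((z-b)^{1/2})`", (2.12));
  under the reflections both branches transform as printed on pp. 29–30 (§VI,
  `domainSpinorSqrtLeft_reflect`: `g^ℛ(w) = conj g(ℛ_a w)`; `domainSpinorSqrtRight_reflect`: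
  `g^ℛ(w) = -conj g(ℛ_b w)`, the un-squared forms of "`f^{(ℛ)} ≡ conj f∘ℛ_a`", "`f^{(ℛ)} ≡ -conj f∘ℛ_b`").

No named fact is introduced; the auxiliary definitions (`spinorPrimCHI`, `domainSpinorSq`, the two
continuations `domainSpinorSqMulLeft/Right` and the two branches `domainSpinorSqrtLeft/Right`)
carry CHI's printed formulae.

## References

* D. Chelkak, C. Hongler, K. Izyurov, *Conformal invariance of spin correlations in the planar Ising
  model*, Ann. of Math. (2) 181 (2015) 1087–1138 = arXiv:1202.2838v2 (numbering of v2): Def. 2.8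
  (2.6)–(2.8), Remark 2.9 (ii) (2.10), Def. 2.11 (2.11)–(2.12), Remark 2.12 (2.13) and the covariance
  rule for `𝒜` after Thm 1.5 ((1.7) of v2), §2.7.2 (2.21), Prop. 3.9, §3.5 (pp. 29–30), Appendix
  Prop. 4.1 (other versions of the paper may number these equations differently). [ChelkakHonglerIzyurovAnnals2015]
-/

noncomputable section

open Filter Topology Metric Set Real Complex
open scoped ComplexConjugate
open Literature.Probability.LatticeModels

namespace Literature.Probability.LatticeModels

/-! ### I. The half-plane spinor squared: partial fractions and symmetries -/

section HalfPlane

variable {a b : ℂ}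

/-- The polynomial identity behind the partial fraction decomposition: with `P = |b-a|`,
`R = |b-ā|`, `(a-ā) · spinorNumSq a b z = (R+P)²(a-ā)(z-b)(z-b̄) - (R+P)(R-P)(b-b̄)(z-a)(z-ā)`
(a consequence of `P² = (b-a)(b̄-ā)`, `R² = (b-ā)(b̄-a)`). [folklore] -/
theorem sub_conj_mul_spinorNumSq (a b z : ℂ) :
    (a - conj a) * spinorNumSq a b z =
      (((‖b - conj a‖ + ‖b - a‖ : ℝ) : ℂ)) ^ 2 * (a - conj a) * ((z - b) * (z - conj b)) -
        ((‖b - conj a‖ + ‖b - a‖ : ℝ) : ℂ) * ((‖b - conj a‖ - ‖b - a‖ : ℝ) : ℂ) * (b - conj b) *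
          ((z - a) * (z - conj a)) := by
  have hP := normSq_sub_cast a b
  have hR := normSq_sub_conj_cast a b
  push_cast at hP hR ⊢
  set P : ℂ := (‖b - a‖ : ℂ) with hPdef
  set R : ℂ := (‖b - conj a‖ : ℂ) with hRdef
  set c : ℂ := conj a with hc
  set d : ℂ := conj b with hd
  unfold spinorNumSq spinorA2 spinorM
  rw [map_mul, map_sub, map_sub, Complex.conj_conj, Complex.conj_conj]
  push_cast
  rw [← hc, ← hd, ← hPdef, ← hRdef]
  linear_combination
    (d * z ^ 2 - b * z ^ 2 + c * z ^ 2 - 2 * c * d * z + c * b * d - a * z ^ 2 + 2 * a * b * z -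
          a * b * d + a * c * d - a * c * b) * hP +
      (-d * z ^ 2 + b * z ^ 2 + c * z ^ 2 - 2 * c * b * z + c * b * d - a * z ^ 2 + 2 * a * d * z -
          a * b * d - a * c * d + a * c * b) * hR

/-- **Partial fractions of `f_{[ℍ,a;b]}²`.** For `a, b ∈ ℍ`, `a ≠ b`, off the four poles,
`f_{[ℍ,a;b]}(z)² = 1/(z-a) - 1/(z-ā) - 𝓑_ℍ(a;b)² (1/(z-b) - 1/(z-b̄))`: the residues are `1` at the
source (Def. 2.8 (2.8)), `-𝓑²` at `b` ((2.7), Def. 2.11 (2.12)), and their negatives at the mirror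
images (CHI15 Appendix, proof of Prop. 4.1: `Re ∫ f² = G_ℍ(·;a) - Σ_s β_s² G_ℍ(·;a_s)` with the
half-plane Green's function `G_ℍ`). [cite: ChelkakHonglerIzyurovAnnals2015, §2.7.2 eq. (2.21) with Def. 2.8; Appendix, proof of Prop. 4.1 (arXiv v2 numbering)] -/
theorem spinorSqCHI_eq_partialFraction (ha : 0 < a.im) (hb : 0 < b.im) (hab : a ≠ b) {z : ℂ}
    (hza : z ≠ a) (hza' : z ≠ conj a) (hzb : z ≠ b) (hzb' : z ≠ conj b) :
    spinorSqCHI a b z =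
      1 / (z - a) - 1 / (z - conj a) - ((bCHI a b ^ 2 : ℝ) : ℂ) * (1 / (z - b) - 1 / (z - conj b)) := by
  obtain ⟨h1, h2, h3, h4, h5, hS⟩ := spinor_ne_zero_aux ha hb hab
  have hS' : (‖b - conj a‖ : ℂ) + (‖b - a‖ : ℂ) ≠ 0 := by exact_mod_cast hS.ne'
  have hza0 : z - a ≠ 0 := sub_ne_zero.2 hza
  have hza0' : z - conj a ≠ 0 := sub_ne_zero.2 hza'
  have hzb0 : z - b ≠ 0 := sub_ne_zero.2 hzb
  have hzb0' : z - conj b ≠ 0 := sub_ne_zero.2 hzb'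
  have key := sub_conj_mul_spinorNumSq a b z
  rw [bCHI_sq ha hb hab]
  -- `C² · NumSq = ((a-ā)(z-b)(z-b̄) - 𝓑²(b-b̄)(z-a)(z-ā)) / 1`, from `key`
  have hC : spinorC2 a b * spinorNumSq a b z =
      (a - conj a) * ((z - b) * (z - conj b)) -
        ((‖b - conj a‖ - ‖b - a‖ : ℝ) : ℂ) / ((‖b - conj a‖ + ‖b - a‖ : ℝ) : ℂ) * (b - conj b) *
          ((z - a) * (z - conj a)) := by
    unfold spinorC2
    rw [div_mul_eq_mul_div, key]
    push_cast
    field_simp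
  unfold spinorSqCHI
  rw [hC]
  push_cast
  field_simp
  ring

/-- **Schwarz symmetry of `f_{[ℍ,a;b]}²`**: `f²(z̄) = -conj (f²(z))` — the squared, reflected form of
the boundary condition (2.6) (`f² ν_out` is real on `ℝ`, `spinorSqCHI_boundary`). [cite: ChelkakHonglerIzyurovAnnals2015, Def. 2.8 eq. (2.6) and §2.7.2 eq. (2.21) (arXiv v2 numbering)] -/
theorem spinorSqCHI_conj (a b z : ℂ) : spinorSqCHI a b (conj z) = -conj (spinorSqCHI a b z) := by
  unfold spinorSqCHI spinorC2 spinorNumSq spinorA2 spinorM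
  simp only [map_div₀, map_mul, map_add, map_sub, map_pow, Complex.conj_conj, Complex.conj_ofReal,
    map_ofNat]
  ring

/-- `|(-b̄) - (-ā)| = |b - a|`. [folklore] -/
theorem norm_neg_conj_sub_neg_conj (a b : ℂ) : ‖-conj b - -conj a‖ = ‖b - a‖ := by
  rw [show -conj b - -conj a = -(conj (b - a)) by rw [map_sub]; ring, norm_neg, Complex.norm_conj]

/-- `|(-b̄) - conj(-ā)| = |b - ā|`. [folklore] -/
theorem norm_neg_conj_sub_conj_neg_conj (a b : ℂ) : ‖-conj b - conj (-conj a)‖ = ‖b - conj a‖ := by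
  rw [map_neg, Complex.conj_conj,
    show -conj b - -a = -(conj (b - conj a)) by rw [map_sub, Complex.conj_conj]; ring,
    norm_neg, Complex.norm_conj]

/-- **`f²` under the reflection `u ↦ -ū` of `ℍ` in the imaginary axis**:
`f_{[ℍ,-ā;-b̄]}(-z̄)² = -conj (f_{[ℍ,a;b]}(z)²)` (the boundary value problem (2.6)–(2.8) of Def. 2.8 is
invariant under anti-conformal automorphisms up to complex conjugation; squared form).
[cite: ChelkakHonglerIzyurovAnnals2015, §3.5 (p. 29: f^{(ℛ)} ≡ conj f ∘ ℛ_a; p. 30: f^{(ℛ)} ≡ -conj f ∘ ℛ_b)] -/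
theorem spinorSqCHI_neg_conj (a b z : ℂ) :
    spinorSqCHI (-conj a) (-conj b) (-conj z) = -conj (spinorSqCHI a b z) := by
  have hn1 := norm_neg_conj_sub_neg_conj a b
  have hn2 := norm_neg_conj_sub_conj_neg_conj a b
  unfold spinorSqCHI spinorC2 spinorNumSq spinorA2 spinorM
  rw [hn1, hn2]
  simp only [map_div₀, map_mul, map_add, map_sub, map_pow, map_neg, Complex.conj_conj,
    Complex.conj_ofReal, map_ofNat]
  ring

/-! ### II. The primitive `h = Re ∫ f² dz` in the half-plane -/

/-- **The primitive `h_{[ℍ,a;b]} = Re ∫ f_{[ℍ,a;b]}² dz`**, normalised to vanish on `∂ℍ`: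
`log|z-a| - log|z-ā| - 𝓑_ℍ(a;b)² (log|z-b| - log|z-b̄|) = -G_ℍ(z;a) + 𝓑² G_ℍ(z;b)` with the Green's
function `G_ℍ(z;c) = log|(z-c̄)/(z-c)|`. [cite: ChelkakHonglerIzyurovAnnals2015, Prop. 3.9; Appendix, proof of Prop. 4.1 (arXiv v2 numbering)] -/
def spinorPrimCHI (a b z : ℂ) : ℝ :=
  Real.log ‖z - a‖ - Real.log ‖z - conj a‖ - bCHI a b ^ 2 * (Real.log ‖z - b‖ - Real.log ‖z - conj b‖)

/-- **`dh = Re(f² dz)`**: off the four poles, `h_{[ℍ,a;b]}` has real Fréchet derivative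
`v ↦ Re(f_{[ℍ,a;b]}(z)² v)`. [cite: ChelkakHonglerIzyurovAnnals2015, Prop. 3.9 (h := Re ∫ f² dz)] -/
theorem hasFDerivAt_spinorPrimCHI (ha : 0 < a.im) (hb : 0 < b.im) (hab : a ≠ b) {z : ℂ}
    (hza : z ≠ a) (hza' : z ≠ conj a) (hzb : z ≠ b) (hzb' : z ≠ conj b) :
    HasFDerivAt (spinorPrimCHI a b) (reMul (spinorSqCHI a b z)) z := by
  have h := ((hasFDerivAt_log_norm_sub hza).sub (hasFDerivAt_log_norm_sub hza')).sub
    (((hasFDerivAt_log_norm_sub hzb).sub (hasFDerivAt_log_norm_sub hzb')).const_smul (bCHI a b ^ 2))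
  have h' : HasFDerivAt (spinorPrimCHI a b) _ z := h
  refine h'.congr_fderiv ?_
  rw [spinorSqCHI_eq_partialFraction ha hb hab hza hza' hzb hzb', reMul_sub, reMul_sub, smul_reMul,
    reMul_sub]
  congr 1
  simp only [one_div]

/-- **Dirichlet boundary values (Prop. 3.9 (1))**: `h_{[ℍ,a;b]} = 0` on `∂ℍ = ℝ`. [cite: ChelkakHonglerIzyurovAnnals2015, Prop. 3.9 (1)] -/
theorem spinorPrimCHI_ofReal (a b : ℂ) (x : ℝ) : spinorPrimCHI a b x = 0 := by
  have h1 : ‖(x : ℂ) - conj a‖ = ‖(x : ℂ) - a‖ := by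
    rw [show (x : ℂ) - conj a = conj ((x : ℂ) - a) by rw [map_sub, Complex.conj_ofReal],
      Complex.norm_conj]
  have h2 : ‖(x : ℂ) - conj b‖ = ‖(x : ℂ) - b‖ := by
    rw [show (x : ℂ) - conj b = conj ((x : ℂ) - b) by rw [map_sub, Complex.conj_ofReal],
      Complex.norm_conj]
  simp [spinorPrimCHI, h1, h2]

end HalfPlane

/-! ### III. The spinor on a simply connected domain (Remark 2.9 (ii), eq. (2.10)) -/

section Domain

variable {Ω : Set ℂ} {φ : ℂ → ℂ} {a b : ℂ}

/-- **CHI's continuum spinor on a simply connected domain, squared**: for a conformal bijection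
`φ : Ω → ℍ`, `f_{[Ω,a;b]}(z)² := f_{[ℍ,φa;φb]}(φ z)² · φ'(z)` — the covariance rule (2.10)
"`f_{[Ω,a;…]}(z) = f_{[φΩ,φa;…]}(φ z) · (φ'(z))^{1/2}` … we use this covariance property to define
the continuous spinor in arbitrary simply connected domain `Ω`", squared.
[cite: ChelkakHonglerIzyurovAnnals2015, Remark 2.9 (ii) eq. (2.10) (arXiv v2 numbering)] -/
def domainSpinorSq (φ : ℂ → ℂ) (a b z : ℂ) : ℂ :=
  spinorSqCHI (φ a) (φ b) (φ z) * deriv φ z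

/-- The four poles of `f_{[ℍ,φa;φb]}²` are avoided by `φ z`, `z ∈ Ω ∖ {a, b}`. [folklore] -/
theorem conformal_apart (hφ : IsConformalBijection φ Ω UpperHalfPlane.upperHalfPlaneSet)
    (ha : a ∈ Ω) (hb : b ∈ Ω) {z : ℂ} (hz : z ∈ Ω) (hza : z ≠ a) (hzb : z ≠ b) :
    φ z ≠ φ a ∧ φ z ≠ conj (φ a) ∧ φ z ≠ φ b ∧ φ z ≠ conj (φ b) := by
  have him : ∀ w ∈ Ω, 0 < (φ w).im := fun w hw => hφ.2.mapsTo hw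
  refine ⟨fun h => hza (hφ.2.injOn hz ha h), fun h => ?_, fun h => hzb (hφ.2.injOn hz hb h), fun h => ?_⟩
  · have h' := congrArg Complex.im h
    rw [Complex.conj_im] at h'
    linarith [him z hz, him a ha]
  · have h' := congrArg Complex.im h
    rw [Complex.conj_im] at h'
    linarith [him z hz, him b hb]

/-- `z ↦ f_{[ℍ,a;b]}(z)²` is complex differentiable off its four poles. [folklore] -/
theorem differentiableAt_spinorSqCHI {a b z : ℂ} (hza : z ≠ a) (hza' : z ≠ conj a) (hzb : z ≠ b)
    (hzb' : z ≠ conj b) : DifferentiableAt ℂ (spinorSqCHI a b) z := by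
  unfold spinorSqCHI spinorNumSq
  have hden : (z - a) * (z - conj a) * (z - b) * (z - conj b) ≠ 0 :=
    mul_ne_zero (mul_ne_zero (mul_ne_zero (sub_ne_zero.2 hza) (sub_ne_zero.2 hza')) (sub_ne_zero.2 hzb))
      (sub_ne_zero.2 hzb')
  exact DifferentiableAt.div (by fun_prop) (by fun_prop) hden

/-- **`f_{[Ω,a;b]}²` is holomorphic on `Ω ∖ {a, b}`** (a holomorphic spinor squared).
[cite: ChelkakHonglerIzyurovAnnals2015, Def. 2.8 and Remark 2.9 (ii)] -/
theorem differentiableOn_domainSpinorSq (hΩ : IsOpen Ω)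
    (hφ : IsConformalBijection φ Ω UpperHalfPlane.upperHalfPlaneSet) (ha : a ∈ Ω) (hb : b ∈ Ω) :
    DifferentiableOn ℂ (domainSpinorSq φ a b) (Ω \ {a, b}) := by
  intro z hz
  have hzΩ : z ∈ Ω := hz.1
  have hza : z ≠ a := fun h => hz.2 (by simp [h])
  have hzb : z ≠ b := fun h => hz.2 (by simp [h])
  obtain ⟨h1, h2, h3, h4⟩ := conformal_apart hφ ha hb hzΩ hza hzb
  have han : AnalyticOnNhd ℂ φ Ω := hφ.1.analyticOnNhd hΩ
  have hd : DifferentiableAt ℂ (domainSpinorSq φ a b) z :=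
    ((differentiableAt_spinorSqCHI h1 h2 h3 h4).comp z (han z hzΩ).differentiableAt).mul
      (han.deriv z hzΩ).differentiableAt
  exact hd.differentiableWithinAt

/-! #### The expansion at the source `a`: (2.8) and `𝒜_Ω` (Def. 2.11 (2.11), Remark 2.12) -/

/-- **The difference quotient of an analytic function is differentiable at the base point, with
derivative `φ''(a)/2`** (`dslope φ a z = (φ z - φ a)/(z - a)`, `= φ'(a)` at `z = a`). [folklore] -/
theorem hasDerivAt_dslope_of_analyticAt {φ : ℂ → ℂ} {a : ℂ} (h : AnalyticAt ℂ φ a) :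
    HasDerivAt (dslope φ a) (deriv (deriv φ) a / 2) a := by
  obtain ⟨p, hp⟩ := h
  set D := dslope φ a with hDdef
  have hD : AnalyticAt ℂ D a := ⟨_, hp.has_fpower_series_dslope_fslope⟩
  have hφeq : ∀ z, φ z = φ a + (z - a) * D z := fun z => by
    have := sub_smul_dslope φ a z
    rw [smul_eq_mul] at this
    linear_combination -this
  have hder : ∀ᶠ z in 𝓝 a, deriv φ z = D z + (z - a) * deriv D z := by
    filter_upwards [hD.eventually_analyticAt] with z hz
    have h1 : HasDerivAt (fun w => φ a + (w - a) * D w) (1 * D z + (z - a) * deriv D z) z :=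
      (((hasDerivAt_id z).sub_const a).mul hz.differentiableAt.hasDerivAt).const_add (φ a)
    have h2 : HasDerivAt φ (1 * D z + (z - a) * deriv D z) z :=
      h1.congr_of_eventuallyEq (Eventually.of_forall fun w => hφeq w)
    rw [h2.deriv, one_mul]
  have hD' : AnalyticAt ℂ (deriv D) a := hD.deriv
  have h2 : HasDerivAt (fun z => D z + (z - a) * deriv D z)
      (deriv D a + (1 * deriv D a + (a - a) * deriv (deriv D) a)) a :=
    hD.differentiableAt.hasDerivAt.add (((hasDerivAt_id a).sub_const a).mul hD'.differentiableAt.hasDerivAt)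
  have h3 : deriv (deriv φ) a = 2 * deriv D a := by
    rw [Filter.EventuallyEq.deriv_eq hder, h2.deriv]
    ring
  have h4 : deriv D a = deriv (deriv φ) a / 2 := by
    rw [h3]
    ring
  rw [← h4]
  exact hD.differentiableAt.hasDerivAt

/-- **The analytic continuation of `(z-a) · f_{[Ω,a;b]}(z)²` across the source `a`**:
`(φ z - φ a) f_{[ℍ,φa;φb]}(φ z)² · φ'(z) (z-a)/(φ z - φ a)`, written with the difference quotient
`dslope φ a`. [cite: ChelkakHonglerIzyurovAnnals2015, Def. 2.11 with Remark 2.9 (ii)] -/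
def domainSpinorSqMulLeft (φ : ℂ → ℂ) (a b z : ℂ) : ℂ :=
  spinorSqMulLeft (φ a) (φ b) (φ z) * (deriv φ z / dslope φ a z)

/-- Off `a` (inside `Ω`), `(z-a) f_{[Ω,a;b]}(z)² = domainSpinorSqMulLeft φ a b z`. [folklore] -/
theorem domainSpinorSq_mul_sub_left (hφ : IsConformalBijection φ Ω UpperHalfPlane.upperHalfPlaneSet)
    (ha : a ∈ Ω) {z : ℂ} (hz : z ∈ Ω) (hza : z ≠ a) :
    domainSpinorSq φ a b z * (z - a) = domainSpinorSqMulLeft φ a b z := by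
  have h1 : φ z ≠ φ a := fun h => hza (hφ.2.injOn hz ha h)
  have h1' : φ z - φ a ≠ 0 := sub_ne_zero.2 h1
  have hza' : z - a ≠ 0 := sub_ne_zero.2 hza
  unfold domainSpinorSq domainSpinorSqMulLeft
  rw [← spinorSqCHI_mul_sub_left h1, dslope_of_ne _ hza, slope_def_field]
  field_simp

/-- **(2.8) on `Ω`: the normalisation at the source is chart-independent** — the continuation of
`(z-a) f_{[Ω,a;b]}²` equals `1` at `a` ("`lim_{z→a} √(z-a) f = 1`", squared).
[cite: ChelkakHonglerIzyurovAnnals2015, Def. 2.8 eq. (2.8) with Remark 2.9 (ii)] -/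
theorem domainSpinorSqMulLeft_self (hΩ : IsOpen Ω)
    (hφ : IsConformalBijection φ Ω UpperHalfPlane.upperHalfPlaneSet) (ha : a ∈ Ω) (hb : b ∈ Ω)
    (hab : a ≠ b) : domainSpinorSqMulLeft φ a b a = 1 := by
  have hφab : φ a ≠ φ b := fun h => hab (hφ.2.injOn ha hb h)
  have hda : deriv φ a ≠ 0 :=
    Literature.Analysis.Complex.SCV.deriv_ne_zero_of_injOn hφ.1 hΩ hφ.2.injOn ha
  unfold domainSpinorSqMulLeft
  rw [dslope_same, spinorSqMulLeft_left (hφ.2.mapsTo ha) (hφ.2.mapsTo hb) hφab, div_self hda, mul_one]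

/-- **Definition 2.11 with the covariance rule for `𝒜` (display after Thm 1.5; Remark 2.12).** The continuation of
`(z-a) f_{[Ω,a;b]}(z)²` has derivative `4 𝒜_Ω(a;b)` at `a`, where
`𝒜_Ω(a;b) = 𝒜_ℍ(φa;φb) · φ'(a) + φ''(a)/(8 φ'(a)) = ACHI φ a b` — i.e. the squared form
`(z-a)f² = 1 + 4𝒜_Ω(z-a) + O((z-a)²)` of CHI's expansion `f = (z-a)^{-1/2} + 2𝒜_Ω (z-a)^{1/2} + …`,
with the printed transformation law of the coefficient ("`𝒜_Ω = 𝒜_φ · φ'(a) + (1/8) φ''(a)/φ'(a)`",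
Remark 2.12). [cite: ChelkakHonglerIzyurovAnnals2015, Def. 2.11 eq. (2.11) and Remark 2.12 (arXiv v2 numbering; the rule is the display after Thm 1.5)] -/
theorem hasDerivAt_domainSpinorSqMulLeft (hΩ : IsOpen Ω)
    (hφ : IsConformalBijection φ Ω UpperHalfPlane.upperHalfPlaneSet) (ha : a ∈ Ω) (hb : b ∈ Ω)
    (hab : a ≠ b) : HasDerivAt (domainSpinorSqMulLeft φ a b) (4 * ACHI φ a b) a := by
  have han : AnalyticOnNhd ℂ φ Ω := hφ.1.analyticOnNhd hΩ
  have hφab : φ a ≠ φ b := fun h => hab (hφ.2.injOn ha hb h)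
  have hia : 0 < (φ a).im := hφ.2.mapsTo ha
  have hib : 0 < (φ b).im := hφ.2.mapsTo hb
  have hda : deriv φ a ≠ 0 :=
    Literature.Analysis.Complex.SCV.deriv_ne_zero_of_injOn hφ.1 hΩ hφ.2.injOn ha
  -- the three factors
  have hS : HasDerivAt (fun z => spinorSqMulLeft (φ a) (φ b) (φ z))
      (4 * ACHI_H (φ a) (φ b) * deriv φ a) a :=
    (hasDerivAt_spinorSqMulLeft hia hib hφab).comp a (han a ha).differentiableAt.hasDerivAt
  have hN : HasDerivAt (deriv φ) (deriv (deriv φ) a) a := (han.deriv a ha).differentiableAt.hasDerivAt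
  have hD : HasDerivAt (dslope φ a) (deriv (deriv φ) a / 2) a := hasDerivAt_dslope_of_analyticAt (han a ha)
  have hDa : dslope φ a a = deriv φ a := dslope_same φ a
  have hQ : HasDerivAt (fun z => deriv φ z / dslope φ a z)
      ((deriv (deriv φ) a * dslope φ a a - deriv φ a * (deriv (deriv φ) a / 2)) / dslope φ a a ^ 2) a :=
    hN.div hD (by rw [hDa]; exact hda)
  have h := hS.mul hQ
  have h' : HasDerivAt (domainSpinorSqMulLeft φ a b) _ a := h
  refine h'.congr_deriv ?_
  rw [hDa, spinorSqMulLeft_left hia hib hφab, div_self hda]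
  unfold ACHI
  field_simp
  ring

/-- **(2.8) on `Ω`, limit form**: `(z-a) f_{[Ω,a;b]}(z)² → 1` as `z → a`.
[cite: ChelkakHonglerIzyurovAnnals2015, Def. 2.8 eq. (2.8) with Remark 2.9 (ii)] -/
theorem tendsto_domainSpinorSq_mul_sub_left (hΩ : IsOpen Ω)
    (hφ : IsConformalBijection φ Ω UpperHalfPlane.upperHalfPlaneSet) (ha : a ∈ Ω) (hb : b ∈ Ω)
    (hab : a ≠ b) : Tendsto (fun z => domainSpinorSq φ a b z * (z - a)) (𝓝[≠] a) (𝓝 1) := by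
  have hc : ContinuousAt (domainSpinorSqMulLeft φ a b) a :=
    (hasDerivAt_domainSpinorSqMulLeft hΩ hφ ha hb hab).continuousAt
  have h := hc.tendsto.mono_left (nhdsWithin_le_nhds (s := ({a}ᶜ : Set ℂ)))
  rw [domainSpinorSqMulLeft_self hΩ hφ ha hb hab] at h
  refine h.congr' ?_
  have hΩa : ∀ᶠ z in 𝓝[≠] a, z ∈ Ω := mem_nhdsWithin_of_mem_nhds (hΩ.mem_nhds ha)
  filter_upwards [hΩa, self_mem_nhdsWithin] with z hz hza
  exact (domainSpinorSq_mul_sub_left hφ ha hz hza).symm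

/-! #### The expansion at the second branch point `b`: (2.12) and the invariance (2.13) of `𝓑` -/

/-- **The analytic continuation of `(z-b) · f_{[Ω,a;b]}(z)²` across `b`.**
[cite: ChelkakHonglerIzyurovAnnals2015, Def. 2.11 eq. (2.12) with Remark 2.9 (ii)] -/
def domainSpinorSqMulRight (φ : ℂ → ℂ) (a b z : ℂ) : ℂ :=
  spinorSqMulRight (φ a) (φ b) (φ z) * (deriv φ z / dslope φ b z)

/-- Off `b` (inside `Ω`), `(z-b) f_{[Ω,a;b]}(z)² = domainSpinorSqMulRight φ a b z`. [folklore] -/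
theorem domainSpinorSq_mul_sub_right (hφ : IsConformalBijection φ Ω UpperHalfPlane.upperHalfPlaneSet)
    (hb : b ∈ Ω) {z : ℂ} (hz : z ∈ Ω) (hzb : z ≠ b) :
    domainSpinorSq φ a b z * (z - b) = domainSpinorSqMulRight φ a b z := by
  have h1 : φ z ≠ φ b := fun h => hzb (hφ.2.injOn hz hb h)
  have h1' : φ z - φ b ≠ 0 := sub_ne_zero.2 h1
  have hzb' : z - b ≠ 0 := sub_ne_zero.2 hzb
  unfold domainSpinorSq domainSpinorSqMulRight
  rw [← spinorSqCHI_mul_sub_right h1, dslope_of_ne _ hzb, slope_def_field]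
  field_simp

/-- **(2.12)–(2.13): `𝓑_Ω(a;b) = 𝓑_ℍ(φa;φb)`.** The continuation of `(z-b) f_{[Ω,a;b]}(z)²` equals
`-𝓑_ℍ(φa;φb)² = -(bCHI (φ a) (φ b))²` at `b`: the coefficient `𝓑` of the expansion
`f_{[Ω,a;b]} = ± i𝓑 (z-b)^{-1/2} + …` is the conformal invariant "`𝓑_Ω(a;b) = 𝓑_{Ω'}(φ(a);φ(b))`"
(2.13), the quantity `𝓑_Ω(a;b) = ⟨σ_aσ_b⟩^free_Ω/⟨σ_aσ_b⟩⁺_Ω` of Theorem 1.7.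
[cite: ChelkakHonglerIzyurovAnnals2015, Def. 2.11 eq. (2.12), Remark 2.12 eq. (2.13), §2.7.2] -/
theorem domainSpinorSqMulRight_self (hΩ : IsOpen Ω)
    (hφ : IsConformalBijection φ Ω UpperHalfPlane.upperHalfPlaneSet) (ha : a ∈ Ω) (hb : b ∈ Ω)
    (hab : a ≠ b) : domainSpinorSqMulRight φ a b b = -((bCHI (φ a) (φ b) ^ 2 : ℝ) : ℂ) := by
  have hφab : φ a ≠ φ b := fun h => hab (hφ.2.injOn ha hb h)
  have hdb : deriv φ b ≠ 0 :=
    Literature.Analysis.Complex.SCV.deriv_ne_zero_of_injOn hφ.1 hΩ hφ.2.injOn hb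
  unfold domainSpinorSqMulRight
  rw [dslope_same, spinorSqMulRight_right (hφ.2.mapsTo ha) (hφ.2.mapsTo hb) hφab, div_self hdb, mul_one]

/-- The continuation across `b` is continuous at `b`. [folklore] -/
theorem continuousAt_domainSpinorSqMulRight (hΩ : IsOpen Ω)
    (hφ : IsConformalBijection φ Ω UpperHalfPlane.upperHalfPlaneSet) (ha : a ∈ Ω) (hb : b ∈ Ω)
    (hab : a ≠ b) : ContinuousAt (domainSpinorSqMulRight φ a b) b := by
  have han : AnalyticOnNhd ℂ φ Ω := hφ.1.analyticOnNhd hΩ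
  obtain ⟨h1, h2, h3, h4, h5, -⟩ := spinor_ne_zero_aux (hφ.2.mapsTo ha) (hφ.2.mapsTo hb)
    (fun h => hab (hφ.2.injOn ha hb h))
  have hdb : deriv φ b ≠ 0 :=
    Literature.Analysis.Complex.SCV.deriv_ne_zero_of_injOn hφ.1 hΩ hφ.2.injOn hb
  have hS : ContinuousAt (spinorSqMulRight (φ a) (φ b)) (φ b) := by
    unfold spinorSqMulRight spinorNumSq
    have hden : (φ b - φ a) * (φ b - conj (φ a)) * (φ b - conj (φ b)) ≠ 0 :=
      mul_ne_zero (mul_ne_zero h2 h4) h5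
    exact ContinuousAt.div (by fun_prop) (by fun_prop) hden
  have hSφ : ContinuousAt (fun z => spinorSqMulRight (φ a) (φ b) (φ z)) b :=
    ContinuousAt.comp_of_eq hS (han b hb).continuousAt rfl
  have hN : ContinuousAt (deriv φ) b := (han.deriv b hb).continuousAt
  have hD : ContinuousAt (dslope φ b) b := continuousAt_dslope_same.2 (han b hb).differentiableAt
  have hDb : dslope φ b b ≠ 0 := by rw [dslope_same]; exact hdb
  exact hSφ.mul (hN.div hD hDb)

/-- **(2.12)–(2.13) on `Ω`, limit form**: `(z-b) f_{[Ω,a;b]}(z)² → -𝓑_ℍ(φa;φb)²` as `z → b`; in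
particular the coefficient `𝓑_Ω(a;b)` of CHI's continuum spinor on `Ω` is `bCHI (φ a) (φ b)` for
every conformal chart `φ : Ω → ℍ`. [cite: ChelkakHonglerIzyurovAnnals2015, Def. 2.11 eq. (2.12) and Remark 2.12 eq. (2.13)] -/
theorem tendsto_domainSpinorSq_mul_sub_right (hΩ : IsOpen Ω)
    (hφ : IsConformalBijection φ Ω UpperHalfPlane.upperHalfPlaneSet) (ha : a ∈ Ω) (hb : b ∈ Ω)
    (hab : a ≠ b) :
    Tendsto (fun z => domainSpinorSq φ a b z * (z - b)) (𝓝[≠] b)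
      (𝓝 (-((bCHI (φ a) (φ b) ^ 2 : ℝ) : ℂ))) := by
  have h := (continuousAt_domainSpinorSqMulRight hΩ hφ ha hb hab).tendsto.mono_left
    (nhdsWithin_le_nhds (s := ({b}ᶜ : Set ℂ)))
  rw [domainSpinorSqMulRight_self hΩ hφ ha hb hab] at h
  refine h.congr' ?_
  have hΩb : ∀ᶠ z in 𝓝[≠] b, z ∈ Ω := mem_nhdsWithin_of_mem_nhds (hΩ.mem_nhds hb)
  filter_upwards [hΩb, self_mem_nhdsWithin] with z hz hzb
  exact (domainSpinorSq_mul_sub_right hφ hb hz hzb).symm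

/-! #### Conformal invariance of the primitive `h = Re ∫ f²` (Prop. 3.9) -/

/-- **`h_{[Ω,a;b]} := h_{[ℍ,φa;φb]} ∘ φ` is a primitive of `Re(f_{[Ω,a;b]}² dz)`**: for
`z ∈ Ω ∖ {a,b}`, `d(h ∘ φ)(z)[v] = Re(f_{[Ω,a;b]}(z)² v)` ("being integrated, the covariance
property (2.10) claims the conformal invariance of `h`", proof of Prop. 3.9).
[cite: ChelkakHonglerIzyurovAnnals2015, Prop. 3.9 (proof, conformal invariance of h)] -/
theorem hasFDerivAt_spinorPrimCHI_comp (hΩ : IsOpen Ω)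
    (hφ : IsConformalBijection φ Ω UpperHalfPlane.upperHalfPlaneSet) (ha : a ∈ Ω) (hb : b ∈ Ω)
    (hab : a ≠ b) {z : ℂ} (hz : z ∈ Ω) (hza : z ≠ a) (hzb : z ≠ b) :
    HasFDerivAt (fun w => spinorPrimCHI (φ a) (φ b) (φ w)) (reMul (domainSpinorSq φ a b z)) z := by
  have han : AnalyticOnNhd ℂ φ Ω := hφ.1.analyticOnNhd hΩ
  have hφab : φ a ≠ φ b := fun h => hab (hφ.2.injOn ha hb h)
  obtain ⟨h1, h2, h3, h4⟩ := conformal_apart hφ ha hb hz hza hzb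
  have hφz : HasDerivAt φ (deriv φ z) z := (han z hz).differentiableAt.hasDerivAt
  have h := (hasFDerivAt_spinorPrimCHI (hφ.2.mapsTo ha) (hφ.2.mapsTo hb) hφab h1 h2 h3 h4).comp z
    (hφz.hasFDerivAt.restrictScalars ℝ)
  rw [reMul_comp_toSpanSingleton] at h
  exact h

end Domain

/-! ### IV. Reflection in a horizontal line (the symmetrisations of §3.5) -/

section Reflection

variable {Ω : Set ℂ} {φ : ℂ → ℂ} {a b : ℂ}

/-- **The reflection `ℛ_t(z) = z̄ + 2it` in the horizontal line `Im z = t`** (CHI15 §3.5: `ℛ_a`,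
`ℛ_b`, reflections in the horizontal axes through the branch points).
[cite: ChelkakHonglerIzyurovAnnals2015, §3.5 (proofs of Thms 2.17 and 2.19)] -/
def reflectIm (t : ℝ) (z : ℂ) : ℂ := conj z + ((2 * t : ℝ) : ℂ) * I

/-- `ℛ_t` is an involution. [folklore] -/
@[simp] theorem reflectIm_reflectIm (t : ℝ) (z : ℂ) : reflectIm t (reflectIm t z) = z := by
  unfold reflectIm
  rw [map_add, map_mul, Complex.conj_conj, Complex.conj_ofReal, Complex.conj_I]
  ring

/-- Real and imaginary parts of `ℛ_t z`: `(Re z, 2t - Im z)`. [folklore] -/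
theorem reflectIm_re_im (t : ℝ) (z : ℂ) : (reflectIm t z).re = z.re ∧ (reflectIm t z).im = 2 * t - z.im := by
  unfold reflectIm
  constructor
  · simp
  · simp
    ring

/-- `ℛ_t` fixes exactly the line `Im z = t`. [folklore] -/
theorem reflectIm_eq_self_iff (t : ℝ) (z : ℂ) : reflectIm t z = z ↔ z.im = t := by
  obtain ⟨hre, him⟩ := reflectIm_re_im t z
  constructor
  · intro h
    have := congrArg Complex.im h
    rw [him] at this
    linarith
  · intro h
    apply Complex.ext
    · exact hre
    · rw [him, h]; ring

/-- `ℛ_t` is continuous. [folklore] -/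
theorem continuous_reflectIm (t : ℝ) : Continuous (reflectIm t) := by
  unfold reflectIm
  fun_prop

/-- `ℛ_t` is injective. [folklore] -/
theorem reflectIm_injective (t : ℝ) : Function.Injective (reflectIm t) := fun z w h => by
  have := congrArg (reflectIm t) h
  rwa [reflectIm_reflectIm, reflectIm_reflectIm] at this

/-- The image of a set under `ℛ_t` is its preimage. [folklore] -/
theorem image_reflectIm (t : ℝ) (Ω : Set ℂ) : reflectIm t '' Ω = reflectIm t ⁻¹' Ω := by
  ext w
  constructor
  · rintro ⟨z, hz, rfl⟩
    show reflectIm t (reflectIm t z) ∈ Ω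
    rwa [reflectIm_reflectIm]
  · intro hw
    exact ⟨reflectIm t w, hw, reflectIm_reflectIm t w⟩

/-- The reflected image of an open set is open. [folklore] -/
theorem isOpen_image_reflectIm (t : ℝ) (hΩ : IsOpen Ω) : IsOpen (reflectIm t '' Ω) := by
  rw [image_reflectIm]
  exact hΩ.preimage (continuous_reflectIm t)

/-- **The reflected chart** `φ^ℛ := -conj ∘ φ ∘ ℛ_t : ℛ_t(Ω) → ℍ` (a conformal map of the
reflected domain onto `ℍ`, composed of `φ` and the two anti-conformal reflections `ℛ_t` and
`u ↦ -ū`). [cite: ChelkakHonglerIzyurovAnnals2015, §3.5 (the spinors F^{(ℛ)}, f^{(ℛ)} of the reflected domain)] -/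
def reflectChart (φ : ℂ → ℂ) (t : ℝ) (w : ℂ) : ℂ := -conj (φ (reflectIm t w))

/-- **The derivative of the reflected chart**: `(φ^ℛ)'(w) = -conj(φ'(ℛ_t w))` (Schwarz reflection).
[folklore] -/
theorem hasDerivAt_reflectChart (t : ℝ) {w : ℂ} (h : DifferentiableAt ℂ φ (reflectIm t w)) :
    HasDerivAt (reflectChart φ t) (-conj (deriv φ (reflectIm t w))) w := by
  set c : ℂ := ((2 * t : ℝ) : ℂ) * I with hc
  have hρ : ∀ u, reflectIm t u = conj u + c := fun u => rfl
  have hg : HasDerivAt (fun u => φ (u + c)) (deriv φ (reflectIm t w)) (conj w) := by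
    have h1 : HasDerivAt (fun u : ℂ => u + c) 1 (conj w) := (hasDerivAt_id _).add_const c
    have h2 : HasDerivAt φ (deriv φ (reflectIm t w)) (conj w + c) := by rw [← hρ]; exact h.hasDerivAt
    have h12 := h2.comp (conj w) h1
    rw [mul_one] at h12
    exact h12
  have h3 := hg.conj_conj
  rw [Complex.conj_conj] at h3
  have h4 : (conj ∘ (fun u => φ (u + c)) ∘ conj) = fun u => conj (φ (reflectIm t u)) := by
    funext u
    simp [Function.comp_apply, hρ]
  rw [h4] at h3
  exact h3.neg

/-- `deriv` form of `hasDerivAt_reflectChart`. [folklore] -/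
theorem deriv_reflectChart (t : ℝ) {w : ℂ} (h : DifferentiableAt ℂ φ (reflectIm t w)) :
    deriv (reflectChart φ t) w = -conj (deriv φ (reflectIm t w)) :=
  (hasDerivAt_reflectChart t h).deriv

/-- **The reflected chart is a conformal bijection `ℛ_t(Ω) → ℍ`.** [cite: ChelkakHonglerIzyurovAnnals2015, §3.5 (ℛ(Ω) is again simply connected with a conformal map onto ℍ)] -/
theorem IsConformalBijection.reflect (hΩ : IsOpen Ω)
    (hφ : IsConformalBijection φ Ω UpperHalfPlane.upperHalfPlaneSet) (t : ℝ) :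
    IsConformalBijection (reflectChart φ t) (reflectIm t '' Ω) UpperHalfPlane.upperHalfPlaneSet := by
  have him : ∀ z ∈ Ω, 0 < (φ z).im := fun z hz => hφ.2.mapsTo hz
  refine ⟨fun w hw => ?_, ?_, ?_, ?_⟩
  · rw [image_reflectIm] at hw
    have hd : DifferentiableAt ℂ φ (reflectIm t w) := hφ.1.differentiableAt (hΩ.mem_nhds hw)
    exact (hasDerivAt_reflectChart t hd).differentiableAt.differentiableWithinAt
  · intro w hw
    rw [image_reflectIm] at hw
    show 0 < (reflectChart φ t w).im
    simp only [reflectChart, Complex.neg_im, Complex.conj_im, neg_neg]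
    exact him _ hw
  · intro w hw w' hw' h
    rw [image_reflectIm] at hw hw'
    have h1 : conj (φ (reflectIm t w)) = conj (φ (reflectIm t w')) := neg_injective h
    have h2 : φ (reflectIm t w) = φ (reflectIm t w') := by
      have := congrArg conj h1
      rwa [Complex.conj_conj, Complex.conj_conj] at this
    exact reflectIm_injective t (hφ.2.injOn hw hw' h2)
  · intro v hv
    have hv' : -conj v ∈ UpperHalfPlane.upperHalfPlaneSet := by
      show 0 < (-conj v).im
      simp only [Complex.neg_im, Complex.conj_im, neg_neg]
      exact hv
    obtain ⟨u, hu, huv⟩ := hφ.2.surjOn hv'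
    refine ⟨reflectIm t u, ⟨u, hu, rfl⟩, ?_⟩
    simp only [reflectChart, reflectIm_reflectIm, huv, map_neg, Complex.conj_conj, neg_neg]

/-- **The reflection identity for the squared spinor**: the spinor of the reflected domain with
reflected branch points, in the reflected chart, is the complex conjugate of the reflected spinor:
`f_{[ℛΩ, ℛa; ℛb]}(w)² = conj (f_{[Ω,a;b]}(ℛ w)²)` — the squared form of CHI's
"`f^{(ℛ)}(z) ≡ conj f(ℛ_a(z))` (since this spinor solves the corresponding boundary value problem)"
(p. 29, reflection in the horizontal line through `a`) and "`f^{(ℛ)}(z) ≡ -conj f(ℛ_b(z))` on the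
sheet `Λ_δ^+`" (p. 30, reflection in the horizontal line through `b`; the sign is a choice of sheet and
disappears upon squaring). [cite: ChelkakHonglerIzyurovAnnals2015, §3.5 (p. 29 and p. 30)] -/
theorem domainSpinorSq_reflect (t : ℝ) {w : ℂ} (h : DifferentiableAt ℂ φ (reflectIm t w)) :
    domainSpinorSq (reflectChart φ t) (reflectIm t a) (reflectIm t b) w =
      conj (domainSpinorSq φ a b (reflectIm t w)) := by
  unfold domainSpinorSq
  rw [deriv_reflectChart t h]
  simp only [reflectChart, reflectIm_reflectIm]
  rw [spinorSqCHI_neg_conj, map_mul]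
  ring

/-- In particular, **when the branch point lies on the axis of reflection** (`Im b = t`, CHI's `ℛ_b`):
`f_{[ℛ_bΩ, ℛ_b a; b]}(w)² = conj (f_{[Ω,a;b]}(ℛ_b w)²)`. [cite: ChelkakHonglerIzyurovAnnals2015, §3.5 (p. 30, proof of Thm 2.19)] -/
theorem domainSpinorSq_reflect_right {w : ℂ} (h : DifferentiableAt ℂ φ (reflectIm b.im w)) :
    domainSpinorSq (reflectChart φ b.im) (reflectIm b.im a) b w =
      conj (domainSpinorSq φ a b (reflectIm b.im w)) := by
  have hb : reflectIm b.im b = b := (reflectIm_eq_self_iff b.im b).2 rfl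
  have key := domainSpinorSq_reflect (φ := φ) (a := a) (b := b) b.im h
  rwa [hb] at key

/-- … and **when the source lies on the axis** (`Im a = t`, CHI's `ℛ_a`):
`f_{[ℛ_aΩ, a; ℛ_a b]}(w)² = conj (f_{[Ω,a;b]}(ℛ_a w)²)`. [cite: ChelkakHonglerIzyurovAnnals2015, §3.5 (p. 29, proof of Thm 2.17)] -/
theorem domainSpinorSq_reflect_left {w : ℂ} (h : DifferentiableAt ℂ φ (reflectIm a.im w)) :
    domainSpinorSq (reflectChart φ a.im) a (reflectIm a.im b) w =
      conj (domainSpinorSq φ a b (reflectIm a.im w)) := by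
  have ha : reflectIm a.im a = a := (reflectIm_eq_self_iff a.im a).2 rfl
  have key := domainSpinorSq_reflect (φ := φ) (a := a) (b := b) a.im h
  rwa [ha] at key

/-- **The coefficient `𝓑` is reflection-invariant**: `𝓑_ℍ(-conj u; -conj v) = 𝓑_ℍ(u; v)`, so that
`𝓑_{ℛΩ}(ℛa; ℛb) = bCHI (φ^ℛ(ℛa)) (φ^ℛ(ℛb)) = bCHI (φ a) (φ b) = 𝓑_Ω(a;b)` ("by symmetry,
`F^{(ℛ)}_δ(b + δ/2) = i𝓑_δ`" uses the same value of `𝓑` for the reflected configuration).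
[cite: ChelkakHonglerIzyurovAnnals2015, §3.5 (p. 30) with Remark 2.12 eq. (2.13)] -/
theorem bCHI_neg_conj (u v : ℂ) : bCHI (-conj u) (-conj v) = bCHI u v := by
  have h1 : uCHI (-conj u) (-conj v) = uCHI u v := by
    unfold uCHI
    rw [norm_neg_conj_sub_neg_conj u v, norm_neg_conj_sub_conj_neg_conj u v]
  unfold bCHI
  rw [h1]

/-- `𝓑` of the reflected configuration in the reflected chart equals `𝓑` of the original one. [cite: ChelkakHonglerIzyurovAnnals2015, §3.5 (p. 30) with Remark 2.12 eq. (2.13)] -/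
theorem bCHI_reflectChart (φ : ℂ → ℂ) (t : ℝ) (a b : ℂ) :
    bCHI (reflectChart φ t (reflectIm t a)) (reflectChart φ t (reflectIm t b)) = bCHI (φ a) (φ b) := by
  simp only [reflectChart, reflectIm_reflectIm]
  exact bCHI_neg_conj _ _

end Reflection

/-! ### V. The branches `f√(z-a)` and `f√(z-b)`: Def. 2.11 un-squared -/

section Branches

variable {Ω : Set ℂ} {φ : ℂ → ℂ} {a b : ℂ}

/-- `𝓑_ℍ(a;b) > 0` for distinct `a, b ∈ ℍ` (`0 < 𝓑² = (|b-ā|-|b-a|)/(|b-ā|+|b-a|)` and `𝓑 ≥ 0`).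
[cite: ChelkakHonglerIzyurovAnnals2015, Def. 2.11 (𝓑 > 0) and §2.7.2] -/
theorem bCHI_pos_of_im_pos {a b : ℂ} (ha : 0 < a.im) (hb : 0 < b.im) (hab : a ≠ b) : 0 < bCHI a b := by
  have hsq : 0 < bCHI a b ^ 2 := by
    rw [bCHI_sq ha hb hab]
    obtain ⟨-, -, -, -, -, hS⟩ := spinor_ne_zero_aux ha hb hab
    exact div_pos (sub_pos.2 (norm_sub_lt_norm_sub_conj ha hb)) hS
  have h0 : 0 ≤ bCHI a b := by unfold bCHI; positivity
  exact lt_of_le_of_ne h0 fun h => by rw [← h] at hsq; simp at hsq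

/-- Differentiability of the continuation `(w-a')f_{[ℍ,a';b']}(w)²` off its three remaining poles. [folklore] -/
theorem differentiableAt_spinorSqMulLeft {a' b' w : ℂ} (h1 : w ≠ conj a') (h2 : w ≠ b') (h3 : w ≠ conj b') :
    DifferentiableAt ℂ (spinorSqMulLeft a' b') w := by
  unfold spinorSqMulLeft spinorNumSq
  have hden : (w - conj a') * (w - b') * (w - conj b') ≠ 0 :=
    mul_ne_zero (mul_ne_zero (sub_ne_zero.2 h1) (sub_ne_zero.2 h2)) (sub_ne_zero.2 h3)
  exact DifferentiableAt.div (by fun_prop) (by fun_prop) hden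

/-- Differentiability of the continuation `(w-b')f_{[ℍ,a';b']}(w)²` off its three remaining poles. [folklore] -/
theorem differentiableAt_spinorSqMulRight {a' b' w : ℂ} (h1 : w ≠ a') (h2 : w ≠ conj a') (h3 : w ≠ conj b') :
    DifferentiableAt ℂ (spinorSqMulRight a' b') w := by
  unfold spinorSqMulRight spinorNumSq
  have hden : (w - a') * (w - conj a') * (w - conj b') ≠ 0 :=
    mul_ne_zero (mul_ne_zero (sub_ne_zero.2 h1) (sub_ne_zero.2 h2)) (sub_ne_zero.2 h3)
  exact DifferentiableAt.div (by fun_prop) (by fun_prop) hden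

/-- The difference quotient `dslope φ c` of a function holomorphic on an open set is differentiable
at every point of the set. [folklore] -/
theorem differentiableAt_dslope_of_analyticOnNhd (han : AnalyticOnNhd ℂ φ Ω) {c z : ℂ}
    (hc : c ∈ Ω) (hz : z ∈ Ω) : DifferentiableAt ℂ (dslope φ c) z := by
  by_cases h : z = c
  · subst h
    exact (hasDerivAt_dslope_of_analyticAt (han z hc)).differentiableAt
  · exact (differentiableAt_dslope_of_ne h).2 (han z hz).differentiableAt

/-- **The continuation of `(z-a)f_{[Ω,a;b]}²` is holomorphic near `a` and stays in the slit plane**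
(it equals `1` at `a`). [folklore] -/
theorem eventually_differentiableAt_domainSpinorSqMulLeft (hΩ : IsOpen Ω)
    (hφ : IsConformalBijection φ Ω UpperHalfPlane.upperHalfPlaneSet) (ha : a ∈ Ω) (hb : b ∈ Ω)
    (hab : a ≠ b) :
    ∀ᶠ z in 𝓝 a, z ∈ Ω ∧ DifferentiableAt ℂ (domainSpinorSqMulLeft φ a b) z ∧
      domainSpinorSqMulLeft φ a b z ∈ slitPlane := by
  have han : AnalyticOnNhd ℂ φ Ω := hφ.1.analyticOnNhd hΩ
  have hia : 0 < (φ a).im := hφ.2.mapsTo ha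
  have hib : 0 < (φ b).im := hφ.2.mapsTo hb
  have hφab : φ a ≠ φ b := fun h => hab (hφ.2.injOn ha hb h)
  have hda : deriv φ a ≠ 0 :=
    Literature.Analysis.Complex.SCV.deriv_ne_zero_of_injOn hφ.1 hΩ hφ.2.injOn ha
  have hφc : ContinuousAt φ a := (han a ha).continuousAt
  -- the pole conditions at `a`, propagated by continuity
  have c1 : φ a ≠ conj (φ a) := fun h => by
    have h' := congrArg Complex.im h; rw [Complex.conj_im] at h'; linarith
  have c3 : φ a ≠ conj (φ b) := fun h => by
    have h' := congrArg Complex.im h; rw [Complex.conj_im] at h'; linarith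
  have E1 : ∀ᶠ z in 𝓝 a, z ∈ Ω := hΩ.mem_nhds ha
  have E2 : ∀ᶠ z in 𝓝 a, φ z ≠ conj (φ a) := hφc.eventually_ne c1
  have E3 : ∀ᶠ z in 𝓝 a, φ z ≠ φ b := hφc.eventually_ne hφab
  have E4 : ∀ᶠ z in 𝓝 a, φ z ≠ conj (φ b) := hφc.eventually_ne c3
  have hDc : ContinuousAt (dslope φ a) a := continuousAt_dslope_same.2 (han a ha).differentiableAt
  have E5 : ∀ᶠ z in 𝓝 a, dslope φ a z ≠ 0 := hDc.eventually_ne (by rw [dslope_same]; exact hda)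
  have hGc : ContinuousAt (domainSpinorSqMulLeft φ a b) a :=
    (hasDerivAt_domainSpinorSqMulLeft hΩ hφ ha hb hab).continuousAt
  have E6 : ∀ᶠ z in 𝓝 a, ‖domainSpinorSqMulLeft φ a b z - 1‖ < 1 := by
    have h := hGc.tendsto.sub_const 1
    rw [domainSpinorSqMulLeft_self hΩ hφ ha hb hab, sub_self] at h
    exact (NormedAddGroup.tendsto_nhds_zero.1 h) 1 one_pos
  filter_upwards [E1, E2, E3, E4, E5, E6] with z hz h2 h3 h4 h5 h6
  refine ⟨hz, ?_, ?_⟩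
  · have hS : DifferentiableAt ℂ (fun w => spinorSqMulLeft (φ a) (φ b) (φ w)) z :=
      (differentiableAt_spinorSqMulLeft h2 h3 h4).comp z (han z hz).differentiableAt
    have hN : DifferentiableAt ℂ (deriv φ) z := (han.deriv z hz).differentiableAt
    have hD : DifferentiableAt ℂ (dslope φ a) z := differentiableAt_dslope_of_analyticOnNhd han ha hz
    exact hS.mul (hN.div hD h5)
  · have : domainSpinorSqMulLeft φ a b z = 1 + (domainSpinorSqMulLeft φ a b z - 1) := by ring
    rw [this]
    exact mem_slitPlane_of_norm_lt_one h6

/-- `(w^{1/2})² = w` for the principal square root. [folklore] -/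
theorem cpow_two_inv_sq (w : ℂ) : (w ^ ((2 : ℂ)⁻¹)) ^ 2 = w := by
  have h := Complex.cpow_nat_inv_pow w two_ne_zero
  have e : ((2 : ℕ) : ℂ)⁻¹ = (2 : ℂ)⁻¹ := by norm_num
  rwa [e] at h

/-- **The branch of `f_{[Ω,a;b]}(z)·(z-a)^{1/2}` equal to `1` at the source**: the principal square
root of the continuation of `(z-a)f²` (well defined and holomorphic near `a`, where the latter is
close to `1`). [cite: ChelkakHonglerIzyurovAnnals2015, Def. 2.8 eq. (2.8) and Def. 2.11 eq. (2.11)] -/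
def domainSpinorSqrtLeft (φ : ℂ → ℂ) (a b z : ℂ) : ℂ :=
  domainSpinorSqMulLeft φ a b z ^ ((2 : ℂ)⁻¹)

/-- It squares to the continuation of `(z-a)f²`. [folklore] -/
theorem domainSpinorSqrtLeft_sq (φ : ℂ → ℂ) (a b z : ℂ) :
    domainSpinorSqrtLeft φ a b z ^ 2 = domainSpinorSqMulLeft φ a b z :=
  cpow_two_inv_sq _

/-- Off `a` (inside `Ω`): `(√(z-a) f)² = f_{[Ω,a;b]}(z)² · (z-a)`. [folklore] -/
theorem domainSpinorSqrtLeft_sq_of_ne (hφ : IsConformalBijection φ Ω UpperHalfPlane.upperHalfPlaneSet)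
    (ha : a ∈ Ω) {z : ℂ} (hz : z ∈ Ω) (hza : z ≠ a) :
    domainSpinorSqrtLeft φ a b z ^ 2 = domainSpinorSq φ a b z * (z - a) := by
  rw [domainSpinorSqrtLeft_sq, domainSpinorSq_mul_sub_left hφ ha hz hza]

/-- **(2.8): `lim_{z→a} √(z-a) f_{[Ω,a;b]}(z) = 1`** — the branch takes the value `1` at `a`.
[cite: ChelkakHonglerIzyurovAnnals2015, Def. 2.8 eq. (2.8)] -/
theorem domainSpinorSqrtLeft_self (hΩ : IsOpen Ω)
    (hφ : IsConformalBijection φ Ω UpperHalfPlane.upperHalfPlaneSet) (ha : a ∈ Ω) (hb : b ∈ Ω)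
    (hab : a ≠ b) : domainSpinorSqrtLeft φ a b a = 1 := by
  unfold domainSpinorSqrtLeft
  rw [domainSpinorSqMulLeft_self hΩ hφ ha hb hab, Complex.one_cpow]

/-- **Definition 2.11, eq. (2.11), un-squared: `√(z-a) f_{[Ω,a;b]}(z) = 1 + 2𝒜_Ω(a;b)(z-a) + o(z-a)`**
with `𝒜_Ω(a;b) = ACHI φ a b` — the branch has complex derivative `2 𝒜_Ω(a;b)` at `a`.
[cite: ChelkakHonglerIzyurovAnnals2015, Def. 2.11 eq. (2.11) with Remark 2.12] -/
theorem hasDerivAt_domainSpinorSqrtLeft (hΩ : IsOpen Ω)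
    (hφ : IsConformalBijection φ Ω UpperHalfPlane.upperHalfPlaneSet) (ha : a ∈ Ω) (hb : b ∈ Ω)
    (hab : a ≠ b) : HasDerivAt (domainSpinorSqrtLeft φ a b) (2 * ACHI φ a b) a := by
  have h := hasDerivAt_domainSpinorSqMulLeft hΩ hφ ha hb hab
  have h1 : domainSpinorSqMulLeft φ a b a = 1 := domainSpinorSqMulLeft_self hΩ hφ ha hb hab
  have hs : domainSpinorSqMulLeft φ a b a ∈ slitPlane := by rw [h1]; exact one_mem_slitPlane
  have h2 := h.cpow_const (c := (2 : ℂ)⁻¹) hs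
  have h3 : HasDerivAt (domainSpinorSqrtLeft φ a b) _ a := h2
  refine h3.congr_deriv ?_
  rw [h1, Complex.one_cpow]
  ring

/-- **The branch `√(z-a) f` is holomorphic on a neighbourhood of the source** (contained in `Ω`).
[cite: ChelkakHonglerIzyurovAnnals2015, Def. 2.11 (the expansion (2.11) is that of a function holomorphic at a)] -/
theorem eventually_differentiableAt_domainSpinorSqrtLeft (hΩ : IsOpen Ω)
    (hφ : IsConformalBijection φ Ω UpperHalfPlane.upperHalfPlaneSet) (ha : a ∈ Ω) (hb : b ∈ Ω)
    (hab : a ≠ b) :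
    ∀ᶠ z in 𝓝 a, z ∈ Ω ∧ DifferentiableAt ℂ (domainSpinorSqrtLeft φ a b) z := by
  filter_upwards [eventually_differentiableAt_domainSpinorSqMulLeft hΩ hφ ha hb hab] with z hz
  exact ⟨hz.1, (hz.2.1.hasDerivAt.cpow_const (c := (2 : ℂ)⁻¹) hz.2.2).differentiableAt⟩

/-- Ball form: **there is `r > 0` with `B(a,r) ⊆ Ω` on which `√(z-a) f_{[Ω,a;b]}` is holomorphic,
equals `1` at `a`, has derivative `2𝒜_Ω(a;b)` there, and squares to `(z-a) f²` off `a`.**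
[cite: ChelkakHonglerIzyurovAnnals2015, Def. 2.8 (2.8) and Def. 2.11 (2.11)] -/
theorem exists_ball_domainSpinorSqrtLeft (hΩ : IsOpen Ω)
    (hφ : IsConformalBijection φ Ω UpperHalfPlane.upperHalfPlaneSet) (ha : a ∈ Ω) (hb : b ∈ Ω)
    (hab : a ≠ b) :
    ∃ r > 0, ball a r ⊆ Ω ∧ DifferentiableOn ℂ (domainSpinorSqrtLeft φ a b) (ball a r) ∧
      domainSpinorSqrtLeft φ a b a = 1 ∧ HasDerivAt (domainSpinorSqrtLeft φ a b) (2 * ACHI φ a b) a ∧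
      ∀ z ∈ ball a r, z ≠ a → domainSpinorSqrtLeft φ a b z ^ 2 = domainSpinorSq φ a b z * (z - a) := by
  obtain ⟨r, hr, hball⟩ := Metric.eventually_nhds_iff_ball.1
    (eventually_differentiableAt_domainSpinorSqrtLeft hΩ hφ ha hb hab)
  exact ⟨r, hr, fun z hz => (hball z hz).1, fun z hz => (hball z hz).2.differentiableWithinAt,
    domainSpinorSqrtLeft_self hΩ hφ ha hb hab, hasDerivAt_domainSpinorSqrtLeft hΩ hφ ha hb hab,
    fun z hz hza => domainSpinorSqrtLeft_sq_of_ne hφ ha (hball z hz).1 hza⟩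

/-- **The continuation of `(z-b)f_{[Ω,a;b]}²` is holomorphic near `b`, where its quotient by
`-𝓑_Ω(a;b)²` stays in the slit plane** (it equals `1` at `b`). [folklore] -/
theorem eventually_differentiableAt_domainSpinorSqMulRight (hΩ : IsOpen Ω)
    (hφ : IsConformalBijection φ Ω UpperHalfPlane.upperHalfPlaneSet) (ha : a ∈ Ω) (hb : b ∈ Ω)
    (hab : a ≠ b) :
    ∀ᶠ z in 𝓝 b, z ∈ Ω ∧ DifferentiableAt ℂ (domainSpinorSqMulRight φ a b) z ∧
      domainSpinorSqMulRight φ a b z / (-((bCHI (φ a) (φ b) : ℂ) ^ 2)) ∈ slitPlane := by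
  have han : AnalyticOnNhd ℂ φ Ω := hφ.1.analyticOnNhd hΩ
  have hia : 0 < (φ a).im := hφ.2.mapsTo ha
  have hib : 0 < (φ b).im := hφ.2.mapsTo hb
  have hφba : φ b ≠ φ a := fun h => hab (hφ.2.injOn ha hb h.symm)
  have hdb : deriv φ b ≠ 0 :=
    Literature.Analysis.Complex.SCV.deriv_ne_zero_of_injOn hφ.1 hΩ hφ.2.injOn hb
  have hB : 0 < bCHI (φ a) (φ b) := bCHI_pos_of_im_pos (hφ.2.mapsTo ha) (hφ.2.mapsTo hb) (fun h => hab (hφ.2.injOn ha hb h))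
  have hB2 : (-((bCHI (φ a) (φ b) : ℂ) ^ 2)) ≠ 0 := by
    rw [neg_ne_zero]; exact pow_ne_zero 2 (by exact_mod_cast hB.ne')
  have hφc : ContinuousAt φ b := (han b hb).continuousAt
  have c2 : φ b ≠ conj (φ a) := fun h => by
    have h' := congrArg Complex.im h; rw [Complex.conj_im] at h'; linarith
  have c3 : φ b ≠ conj (φ b) := fun h => by
    have h' := congrArg Complex.im h; rw [Complex.conj_im] at h'; linarith
  have E1 : ∀ᶠ z in 𝓝 b, z ∈ Ω := hΩ.mem_nhds hb
  have E2 : ∀ᶠ z in 𝓝 b, φ z ≠ φ a := hφc.eventually_ne hφba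
  have E3 : ∀ᶠ z in 𝓝 b, φ z ≠ conj (φ a) := hφc.eventually_ne c2
  have E4 : ∀ᶠ z in 𝓝 b, φ z ≠ conj (φ b) := hφc.eventually_ne c3
  have hDc : ContinuousAt (dslope φ b) b := continuousAt_dslope_same.2 (han b hb).differentiableAt
  have E5 : ∀ᶠ z in 𝓝 b, dslope φ b z ≠ 0 := hDc.eventually_ne (by rw [dslope_same]; exact hdb)
  have hQc : ContinuousAt (domainSpinorSqMulRight φ a b) b :=
    continuousAt_domainSpinorSqMulRight hΩ hφ ha hb hab
  have E6 : ∀ᶠ z in 𝓝 b,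
      ‖domainSpinorSqMulRight φ a b z / (-((bCHI (φ a) (φ b) : ℂ) ^ 2)) - 1‖ < 1 := by
    have h := (hQc.tendsto.div_const (-((bCHI (φ a) (φ b) : ℂ) ^ 2))).sub_const 1
    rw [domainSpinorSqMulRight_self hΩ hφ ha hb hab] at h
    have e : -(((bCHI (φ a) (φ b) ^ 2 : ℝ)) : ℂ) / (-((bCHI (φ a) (φ b) : ℂ) ^ 2)) - 1 = 0 := by
      push_cast
      rw [div_self hB2, sub_self]
    rw [e] at h
    exact (NormedAddGroup.tendsto_nhds_zero.1 h) 1 one_pos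
  filter_upwards [E1, E2, E3, E4, E5, E6] with z hz h2 h3 h4 h5 h6
  refine ⟨hz, ?_, ?_⟩
  · have hS : DifferentiableAt ℂ (fun w => spinorSqMulRight (φ a) (φ b) (φ w)) z :=
      (differentiableAt_spinorSqMulRight h2 h3 h4).comp z (han z hz).differentiableAt
    have hN : DifferentiableAt ℂ (deriv φ) z := (han.deriv z hz).differentiableAt
    have hD : DifferentiableAt ℂ (dslope φ b) z := differentiableAt_dslope_of_analyticOnNhd han hb hz
    exact hS.mul (hN.div hD h5)
  · have : domainSpinorSqMulRight φ a b z / (-((bCHI (φ a) (φ b) : ℂ) ^ 2)) =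
        1 + (domainSpinorSqMulRight φ a b z / (-((bCHI (φ a) (φ b) : ℂ) ^ 2)) - 1) := by ring
    rw [this]
    exact mem_slitPlane_of_norm_lt_one h6

/-- **The branch of `f_{[Ω,a;b]}(z)·(z-b)^{1/2}` equal to `+i𝓑_Ω(a;b)` at `b`**:
`i𝓑 · ((z-b)f² / (-𝓑²))^{1/2}` with the principal square root (well defined and holomorphic near
`b`, where the radicand is close to `1`); `𝓑 = bCHI (φ a) (φ b)`.
[cite: ChelkakHonglerIzyurovAnnals2015, Def. 2.11 eq. (2.12)] -/
def domainSpinorSqrtRight (φ : ℂ → ℂ) (a b z : ℂ) : ℂ :=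
  I * (bCHI (φ a) (φ b) : ℂ) *
    (domainSpinorSqMulRight φ a b z / (-((bCHI (φ a) (φ b) : ℂ) ^ 2))) ^ ((2 : ℂ)⁻¹)

/-- It squares to the continuation of `(z-b)f²` (when `𝓑 ≠ 0`). [folklore] -/
theorem domainSpinorSqrtRight_sq (hB : bCHI (φ a) (φ b) ≠ 0) (z : ℂ) :
    domainSpinorSqrtRight φ a b z ^ 2 = domainSpinorSqMulRight φ a b z := by
  have hB' : (bCHI (φ a) (φ b) : ℂ) ≠ 0 := by exact_mod_cast hB
  have hB2 : (-((bCHI (φ a) (φ b) : ℂ) ^ 2)) ≠ 0 := by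
    rw [neg_ne_zero]; exact pow_ne_zero 2 hB'
  unfold domainSpinorSqrtRight
  rw [mul_pow, mul_pow, cpow_two_inv_sq, Complex.I_sq]
  field_simp

/-- Off `b` (inside `Ω`): `(√(z-b) f)² = f_{[Ω,a;b]}(z)² · (z-b)`. [folklore] -/
theorem domainSpinorSqrtRight_sq_of_ne (hφ : IsConformalBijection φ Ω UpperHalfPlane.upperHalfPlaneSet)
    (ha : a ∈ Ω) (hb : b ∈ Ω) (hab : a ≠ b) {z : ℂ} (hz : z ∈ Ω) (hzb : z ≠ b) :
    domainSpinorSqrtRight φ a b z ^ 2 = domainSpinorSq φ a b z * (z - b) := by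
  rw [domainSpinorSqrtRight_sq (bCHI_pos_of_im_pos (hφ.2.mapsTo ha) (hφ.2.mapsTo hb) (fun h => hab (hφ.2.injOn ha hb h))).ne', domainSpinorSq_mul_sub_right hφ hb hz hzb]

/-- **(2.12): `lim_{z→b} √(z-b) f_{[Ω,a;b]}(z) = ± i𝓑_Ω(a;b)`** — the branch takes the value
`+i · bCHI (φ a) (φ b)` at `b` (the other sheet carries the opposite sign).
[cite: ChelkakHonglerIzyurovAnnals2015, Def. 2.11 eq. (2.12) with Remark 2.12 eq. (2.13)] -/
theorem domainSpinorSqrtRight_self (hΩ : IsOpen Ω)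
    (hφ : IsConformalBijection φ Ω UpperHalfPlane.upperHalfPlaneSet) (ha : a ∈ Ω) (hb : b ∈ Ω)
    (hab : a ≠ b) : domainSpinorSqrtRight φ a b b = I * (bCHI (φ a) (φ b) : ℂ) := by
  have hB : 0 < bCHI (φ a) (φ b) := bCHI_pos_of_im_pos (hφ.2.mapsTo ha) (hφ.2.mapsTo hb) (fun h => hab (hφ.2.injOn ha hb h))
  have hB2 : (-((bCHI (φ a) (φ b) : ℂ) ^ 2)) ≠ 0 := by
    rw [neg_ne_zero]; exact pow_ne_zero 2 (by exact_mod_cast hB.ne')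
  unfold domainSpinorSqrtRight
  rw [domainSpinorSqMulRight_self hΩ hφ ha hb hab]
  have e : -(((bCHI (φ a) (φ b) ^ 2 : ℝ)) : ℂ) / (-((bCHI (φ a) (φ b) : ℂ) ^ 2)) = 1 := by
    push_cast
    exact div_self hB2
  rw [e, Complex.one_cpow, mul_one]

/-- **The branch `√(z-b) f` is holomorphic on a neighbourhood of `b`** (contained in `Ω`): CHI's
"`f_{[Ω,a;b]} = ± i𝓑 (z-b)^{-1/2} + O((z-b)^{1/2})`", indeed `√(z-b) f - i𝓑 = O(z-b)`.
[cite: ChelkakHonglerIzyurovAnnals2015, Def. 2.11 eq. (2.12)] -/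
theorem eventually_differentiableAt_domainSpinorSqrtRight (hΩ : IsOpen Ω)
    (hφ : IsConformalBijection φ Ω UpperHalfPlane.upperHalfPlaneSet) (ha : a ∈ Ω) (hb : b ∈ Ω)
    (hab : a ≠ b) :
    ∀ᶠ z in 𝓝 b, z ∈ Ω ∧ DifferentiableAt ℂ (domainSpinorSqrtRight φ a b) z := by
  filter_upwards [eventually_differentiableAt_domainSpinorSqMulRight hΩ hφ ha hb hab] with z hz
  refine ⟨hz.1, ?_⟩
  have h1 : DifferentiableAt ℂ
      (fun w => domainSpinorSqMulRight φ a b w / (-((bCHI (φ a) (φ b) : ℂ) ^ 2))) z :=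
    hz.2.1.div_const _
  have h2 := (h1.hasDerivAt.cpow_const (c := (2 : ℂ)⁻¹) hz.2.2).differentiableAt
  exact h2.const_mul (I * (bCHI (φ a) (φ b) : ℂ))

/-- Ball form: **there is `r > 0` with `B(b,r) ⊆ Ω` on which `√(z-b) f_{[Ω,a;b]}` is holomorphic,
equals `i𝓑_Ω(a;b) = i · bCHI (φ a) (φ b)` at `b`, and squares to `(z-b) f²` off `b`.**
[cite: ChelkakHonglerIzyurovAnnals2015, Def. 2.11 (2.12), Remark 2.12 (2.13)] -/
theorem exists_ball_domainSpinorSqrtRight (hΩ : IsOpen Ω)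
    (hφ : IsConformalBijection φ Ω UpperHalfPlane.upperHalfPlaneSet) (ha : a ∈ Ω) (hb : b ∈ Ω)
    (hab : a ≠ b) :
    ∃ r > 0, ball b r ⊆ Ω ∧ DifferentiableOn ℂ (domainSpinorSqrtRight φ a b) (ball b r) ∧
      domainSpinorSqrtRight φ a b b = I * (bCHI (φ a) (φ b) : ℂ) ∧
      ∀ z ∈ ball b r, z ≠ b →
        domainSpinorSqrtRight φ a b z ^ 2 = domainSpinorSq φ a b z * (z - b) := by
  obtain ⟨r, hr, hball⟩ := Metric.eventually_nhds_iff_ball.1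
    (eventually_differentiableAt_domainSpinorSqrtRight hΩ hφ ha hb hab)
  exact ⟨r, hr, fun z hz => (hball z hz).1, fun z hz => (hball z hz).2.differentiableWithinAt,
    domainSpinorSqrtRight_self hΩ hφ ha hb hab,
    fun z hz hzb => domainSpinorSqrtRight_sq_of_ne hφ ha hb hab (hball z hz).1 hzb⟩

end Branches

/-! ### VI. The branches under the reflections `ℛ_a`, `ℛ_b` (CHI §3.5, un-squared) -/

section BranchReflection

variable {Ω : Set ℂ} {φ : ℂ → ℂ} {a b : ℂ}

/-- The numerator `C² · NumSq` of `f²` under `u ↦ -ū`: it picks up `-conj`. [folklore] -/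
theorem spinorC2_mul_spinorNumSq_neg_conj (a' b' w : ℂ) :
    spinorC2 (-conj a') (-conj b') * spinorNumSq (-conj a') (-conj b') (-conj w) =
      -conj (spinorC2 a' b' * spinorNumSq a' b' w) := by
  have hn1 := norm_neg_conj_sub_neg_conj a' b'
  have hn2 := norm_neg_conj_sub_conj_neg_conj a' b'
  unfold spinorC2 spinorNumSq spinorA2 spinorM
  rw [hn1, hn2]
  simp only [map_div₀, map_mul, map_add, map_sub, map_pow, map_neg, Complex.conj_conj,
    Complex.conj_ofReal, map_ofNat]
  ring

/-- `(w-a') f²` continued, under `u ↦ -ū` (three denominators remain, so the sign of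
`spinorSqCHI_neg_conj` disappears). [folklore] -/
theorem spinorSqMulLeft_neg_conj (a' b' w : ℂ) :
    spinorSqMulLeft (-conj a') (-conj b') (-conj w) = conj (spinorSqMulLeft a' b' w) := by
  unfold spinorSqMulLeft
  have hD : (-conj w - conj (-conj a')) * (-conj w - -conj b') * (-conj w - conj (-conj b')) =
      -conj ((w - conj a') * (w - b') * (w - conj b')) := by
    simp only [map_mul, map_sub, map_neg, Complex.conj_conj]
    ring
  rw [spinorC2_mul_spinorNumSq_neg_conj, hD, neg_div_neg_eq, map_div₀]

/-- `(w-b') f²` continued, under `u ↦ -ū`: `spinorSqMulRight (-ā') (-b̄') (-w̄) = conj (spinorSqMulRight a' b' w)`. [folklore] -/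
theorem spinorSqMulRight_neg_conj (a' b' w : ℂ) :
    spinorSqMulRight (-conj a') (-conj b') (-conj w) = conj (spinorSqMulRight a' b' w) := by
  unfold spinorSqMulRight
  have hD : (-conj w - -conj a') * (-conj w - conj (-conj a')) * (-conj w - conj (-conj b')) =
      -conj ((w - a') * (w - conj a') * (w - conj b')) := by
    simp only [map_mul, map_sub, map_neg, Complex.conj_conj]
    ring
  rw [spinorC2_mul_spinorNumSq_neg_conj, hD, neg_div_neg_eq, map_div₀]

/-- **The difference quotient of the reflected chart**: `dslope φ^ℛ (ℛc) w = -conj (dslope φ c (ℛ w))`.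
[folklore] -/
theorem dslope_reflectChart (t : ℝ) {c w : ℂ} (hc : DifferentiableAt ℂ φ c) :
    dslope (reflectChart φ t) (reflectIm t c) w = -conj (dslope φ c (reflectIm t w)) := by
  by_cases hw : w = reflectIm t c
  · subst hw
    rw [dslope_same, reflectIm_reflectIm, dslope_same]
    have hc' : DifferentiableAt ℂ φ (reflectIm t (reflectIm t c)) := by rwa [reflectIm_reflectIm]
    rw [deriv_reflectChart t hc', reflectIm_reflectIm]
  · have hw' : reflectIm t w ≠ c := fun h => hw (by rw [← h, reflectIm_reflectIm])
    rw [dslope_of_ne _ hw, dslope_of_ne _ hw', slope_def_field, slope_def_field]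
    simp only [reflectChart, reflectIm_reflectIm]
    have e1 : reflectIm t w - c = conj (w - reflectIm t c) := by
      unfold reflectIm
      simp only [map_sub, map_add, map_mul, Complex.conj_conj, Complex.conj_ofReal, Complex.conj_I]
      ring
    rw [e1, map_div₀, Complex.conj_conj, map_sub]
    have hne : w - reflectIm t c ≠ 0 := sub_ne_zero.2 hw
    field_simp
    ring

/-- **The continuation of `(z-a)f²` for the configuration reflected in the horizontal line through
the source** is the conjugate of the reflected one: `G^ℛ(w) = conj G(ℛ_a w)`. [cite: ChelkakHonglerIzyurovAnnals2015, §3.5 (p. 29, proof of Thm 2.17)] -/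
theorem domainSpinorSqMulLeft_reflect {w : ℂ} (ha : DifferentiableAt ℂ φ a)
    (hw : DifferentiableAt ℂ φ (reflectIm a.im w)) :
    domainSpinorSqMulLeft (reflectChart φ a.im) a (reflectIm a.im b) w =
      conj (domainSpinorSqMulLeft φ a b (reflectIm a.im w)) := by
  have haR : reflectIm a.im a = a := (reflectIm_eq_self_iff a.im a).2 rfl
  have hd := dslope_reflectChart (φ := φ) a.im (w := w) ha
  rw [haR] at hd
  unfold domainSpinorSqMulLeft
  rw [hd, deriv_reflectChart a.im hw]
  have e : reflectChart φ a.im a = -conj (φ a) := by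
    show -conj (φ (reflectIm a.im a)) = -conj (φ a)
    rw [haR]
  rw [e]
  simp only [reflectChart, reflectIm_reflectIm]
  rw [spinorSqMulLeft_neg_conj, map_mul, map_div₀, neg_div_neg_eq]

/-- **The continuation of `(z-b)f²` for the configuration reflected in the horizontal line through
`b`**: `Q^ℛ(w) = conj Q(ℛ_b w)`. [cite: ChelkakHonglerIzyurovAnnals2015, §3.5 (p. 30, proof of Thm 2.19)] -/
theorem domainSpinorSqMulRight_reflect {w : ℂ} (hb : DifferentiableAt ℂ φ b)
    (hw : DifferentiableAt ℂ φ (reflectIm b.im w)) :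
    domainSpinorSqMulRight (reflectChart φ b.im) (reflectIm b.im a) b w =
      conj (domainSpinorSqMulRight φ a b (reflectIm b.im w)) := by
  have hbR : reflectIm b.im b = b := (reflectIm_eq_self_iff b.im b).2 rfl
  have hd := dslope_reflectChart (φ := φ) b.im (w := w) hb
  rw [hbR] at hd
  unfold domainSpinorSqMulRight
  rw [hd, deriv_reflectChart b.im hw]
  have e : reflectChart φ b.im b = -conj (φ b) := by
    show -conj (φ (reflectIm b.im b)) = -conj (φ b)
    rw [hbR]
  rw [e]
  simp only [reflectChart, reflectIm_reflectIm]
  rw [spinorSqMulRight_neg_conj, map_mul, map_div₀, neg_div_neg_eq]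

/-- The principal square root commutes with conjugation on the slit plane. [folklore] -/
theorem conj_cpow_two_inv {x : ℂ} (hx : x ∈ slitPlane) :
    (conj x) ^ ((2 : ℂ)⁻¹) = conj (x ^ ((2 : ℂ)⁻¹)) := by
  have harg : x.arg ≠ π := (Complex.mem_slitPlane_iff_arg.1 hx).1
  rw [Complex.conj_cpow _ _ harg]
  congr 2
  rw [map_inv₀, map_ofNat]

/-- **CHI p. 29, un-squared: `f^{(ℛ)}(z) ≡ conj f(ℛ_a z)`** for the branches `√(z-a)·f` normalised
by `+1` at the common source `a`: `g^ℛ(w) = conj g(ℛ_a w)` wherever the radicand lies in the slit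
plane (in particular near `a`). [cite: ChelkakHonglerIzyurovAnnals2015, §3.5 (p. 29: "it is easy to check that f^{(ℛ)}(z) ≡ conj f(ℛ_a(z))")] -/
theorem domainSpinorSqrtLeft_reflect {w : ℂ} (ha : DifferentiableAt ℂ φ a)
    (hw : DifferentiableAt ℂ φ (reflectIm a.im w))
    (hs : domainSpinorSqMulLeft φ a b (reflectIm a.im w) ∈ slitPlane) :
    domainSpinorSqrtLeft (reflectChart φ a.im) a (reflectIm a.im b) w =
      conj (domainSpinorSqrtLeft φ a b (reflectIm a.im w)) := by
  unfold domainSpinorSqrtLeft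
  rw [domainSpinorSqMulLeft_reflect ha hw, conj_cpow_two_inv hs]

/-- **CHI p. 30, un-squared: `f^{(ℛ)}(z) ≡ -conj f(ℛ_b z)`** for the branches `√(z-b)·f` normalised
by `+i𝓑` at the common branch point `b` ("if one fixes the sheet for `F^{(ℛ)}` by the same condition
`F^{(ℛ)}(b + δ/2) ∈ iℝ₊`"): `g^ℛ(w) = -conj g(ℛ_b w)` wherever the normalised radicand lies in the slit
plane (in particular near `b`). [cite: ChelkakHonglerIzyurovAnnals2015, §3.5 (p. 30: "f^{(ℛ)}(z) ≡ -conj f(ℛ_b(z)) on the sheet Λ_δ^+")] -/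
theorem domainSpinorSqrtRight_reflect {w : ℂ} (hb : DifferentiableAt ℂ φ b)
    (hw : DifferentiableAt ℂ φ (reflectIm b.im w))
    (hs : domainSpinorSqMulRight φ a b (reflectIm b.im w) / (-((bCHI (φ a) (φ b) : ℂ) ^ 2)) ∈ slitPlane) :
    domainSpinorSqrtRight (reflectChart φ b.im) (reflectIm b.im a) b w =
      -conj (domainSpinorSqrtRight φ a b (reflectIm b.im w)) := by
  have hbR : reflectIm b.im b = b := (reflectIm_eq_self_iff b.im b).2 rfl
  have hB : bCHI (reflectChart φ b.im (reflectIm b.im a)) (reflectChart φ b.im b) = bCHI (φ a) (φ b) := by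
    have h := bCHI_reflectChart φ b.im a b
    rwa [hbR] at h
  unfold domainSpinorSqrtRight
  rw [hB, domainSpinorSqMulRight_reflect hb hw]
  have e : conj (domainSpinorSqMulRight φ a b (reflectIm b.im w)) / (-((bCHI (φ a) (φ b) : ℂ) ^ 2)) =
      conj (domainSpinorSqMulRight φ a b (reflectIm b.im w) / (-((bCHI (φ a) (φ b) : ℂ) ^ 2))) := by
    rw [map_div₀, map_neg, map_pow, Complex.conj_ofReal]
  rw [e, conj_cpow_two_inv hs]
  simp only [map_mul, Complex.conj_I, Complex.conj_ofReal]
  ring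

/-- Near `b` the hypotheses of `domainSpinorSqrtRight_reflect` hold: **eventually in `w → b`,
`g^ℛ(w) = -conj g(ℛ_b w)`** (note `ℛ_b w → b`). [cite: ChelkakHonglerIzyurovAnnals2015, §3.5 (p. 30)] -/
theorem eventually_domainSpinorSqrtRight_reflect (hΩ : IsOpen Ω)
    (hφ : IsConformalBijection φ Ω UpperHalfPlane.upperHalfPlaneSet) (ha : a ∈ Ω) (hb : b ∈ Ω)
    (hab : a ≠ b) :
    ∀ᶠ w in 𝓝 b, domainSpinorSqrtRight (reflectChart φ b.im) (reflectIm b.im a) b w =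
      -conj (domainSpinorSqrtRight φ a b (reflectIm b.im w)) := by
  have han : AnalyticOnNhd ℂ φ Ω := hφ.1.analyticOnNhd hΩ
  have hbR : reflectIm b.im b = b := (reflectIm_eq_self_iff b.im b).2 rfl
  have hR : Tendsto (reflectIm b.im) (𝓝 b) (𝓝 b) := by
    have h := (continuous_reflectIm b.im).tendsto b
    rwa [hbR] at h
  have hE := hR.eventually (eventually_differentiableAt_domainSpinorSqMulRight hΩ hφ ha hb hab)
  filter_upwards [hE] with w hw
  exact domainSpinorSqrtRight_reflect (han b hb).differentiableAt (han _ hw.1).differentiableAt hw.2.2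

/-- Near `a`: **eventually in `w → a`, `g^ℛ(w) = conj g(ℛ_a w)`** for the branches `√(z-a)·f`.
[cite: ChelkakHonglerIzyurovAnnals2015, §3.5 (p. 29)] -/
theorem eventually_domainSpinorSqrtLeft_reflect (hΩ : IsOpen Ω)
    (hφ : IsConformalBijection φ Ω UpperHalfPlane.upperHalfPlaneSet) (ha : a ∈ Ω) (hb : b ∈ Ω)
    (hab : a ≠ b) :
    ∀ᶠ w in 𝓝 a, domainSpinorSqrtLeft (reflectChart φ a.im) a (reflectIm a.im b) w =
      conj (domainSpinorSqrtLeft φ a b (reflectIm a.im w)) := by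
  have han : AnalyticOnNhd ℂ φ Ω := hφ.1.analyticOnNhd hΩ
  have haR : reflectIm a.im a = a := (reflectIm_eq_self_iff a.im a).2 rfl
  have hR : Tendsto (reflectIm a.im) (𝓝 a) (𝓝 a) := by
    have h := (continuous_reflectIm a.im).tendsto a
    rwa [haR] at h
  have hE := hR.eventually (eventually_differentiableAt_domainSpinorSqMulLeft hΩ hφ ha hb hab)
  filter_upwards [hE] with w hw
  exact domainSpinorSqrtLeft_reflect (han a ha).differentiableAt (han _ hw.1).differentiableAt hw.2.2

end BranchReflection

end Literature.Probability.LatticeModels
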